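import Literature.Analysis.FluidPDE.SelfSimilar
import Literature.Analysis.FluidPDE.TsaiSelfSimilarBounded
import HarnessLib

/-!
# `SpiralScalingLiouville` (stmt-NavierStokesRegularity-8216), line `registered` (birth skeleton):
# stub `stub_rotatedProfileLiouvilleRateZero` — the rate-zero leaf `A = 0` (Tsai 1998, Thm 1)

The rotated Leray profile system `−ΔU + ½U + ½∇U·(y + Ay) − ½AU + (U·∇)U + ∇P = 0` with skew
rate `A = 0` is LERAY's profile equation (Leray 1934, (3.12)) with viscosity `ν = 1` and rate
`a = ½`, i.e. the tree's `IsLerayProfile 1 ½ U P`. A smooth divergence-free solution with the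
Type-I decay `‖U(y)‖ ≤ K/(‖y‖ + 1)` is in particular bounded (`‖y‖ + 1 ≥ 1`), hence constant by
Tsai 1998, Theorem 1 at `q = ∞` (PROVED in tree:
`Literature.Analysis.FluidPDE.IsLerayProfile.exists_eq_const_of_bounded`), `U ≡ c`; and the decay
along the ray `r e₁`, `‖c‖ ≤ K/(r + 1)` for every `r ≥ 0`, forces `c = 0` (take
`r = |K|/‖c‖` if `c ≠ 0`).

## References

* T.-P. Tsai, Arch. Rational Mech. Anal. 143 (1998) 29–51, Theorem 1 (p. 31). [Tsai1998]
* J. Leray, Acta Math. 63 (1934) 193–248, (3.12). [Leray1934]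
* B. Pineau, V. Vicol, arXiv:2607.09619 (2026), (1.8), Remark 1.2 (the case `α = 0`). [PineauVicol2026]
-/

noncomputable section

-- the summit and its single problem share the name (D-0017 nested layout)
set_option linter.dupNamespace false

open Set Function
open scoped ContDiff Laplacian
open Literature.Analysis.FluidPDE

namespace Summit.NavierStokesRegularity.NavierStokesRegularity.Theorems.SpiralScalingLiouville.Birth

/-- Local notation for physical space `ℝ³`. -/
local notation "E3" => EuclideanSpace ℝ (Fin 3)

/-- **Stub 2a — the rate-zero leaf of the rotated profile Liouville theorem (Tsai 1998, Thm 1 at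
`q = ∞`, plus the Type-I decay).** A smooth divergence-free solution `(U, P)` (`P ∈ C¹`) of
Leray's profile equation `−ΔU + ½U + ½(y·∇)U + (U·∇)U + ∇P = 0` on `ℝ³` with
`‖U(y)‖ ≤ K/(‖y‖ + 1)` vanishes identically: `(U, P)` is an `IsLerayProfile 1 ½` pair, `U` is
bounded by `|K|`, so `U ≡ c` by `IsLerayProfile.exists_eq_const_of_bounded` (Tsai's Theorem 1,
`q = ∞`, proved in the tree), and `‖c‖ = ‖U(r e₁)‖ ≤ |K|/(r + 1)` for all `r ≥ 0` gives `c = 0`.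
[cite: Tsai1998, Thm 1 (p. 31)] -/
theorem stub_rotatedProfileLiouvilleRateZero :
    ∀ (U : E3 → E3) (P : E3 → ℝ), ContDiff ℝ ∞ U → ContDiff ℝ 1 P →
      VectorCalculus.IsDivFree U →
      (∀ y, -((Δ U) y) + (1 / 2 : ℝ) • U y + (1 / 2 : ℝ) • fderiv ℝ U y y + convect U U y + gradient P y = 0) →
      (∃ K : ℝ, ∀ y, ‖U y‖ ≤ K / (‖y‖ + 1)) →
      U = 0 := by
  intro U P hU hP hdiv heq hdec
  obtain ⟨K, hK⟩ := hdec
  -- Leray's profile system with `ν = 1`, `a = ½`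
  have hprof : IsLerayProfile 1 (1 / 2) U P :=
    { contDiff_velocity := contDiff_infty.1 hU 2
      contDiff_pressure := hP
      profile_eq := fun y => by
        rw [one_smul]
        exact heq y
      divFree := hdiv }
  -- the decay bound dominates by `|K|`: `K/(‖y‖ + 1) ≤ |K|/(‖y‖ + 1) ≤ |K|`
  have hK' : ∀ y : E3, ‖U y‖ ≤ |K| / (‖y‖ + 1) := fun y =>
    (hK y).trans (div_le_div_of_nonneg_right (le_abs_self K) (by positivity))
  have hbd : ∃ M : ℝ, ∀ y, ‖U y‖ ≤ M :=
    ⟨|K|, fun y => (hK' y).trans (div_le_self (abs_nonneg K) (by linarith [norm_nonneg y]))⟩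
  -- Tsai 1998, Theorem 1 (`q = ∞`): the bounded profile is constant
  obtain ⟨c, hc⟩ := hprof.exists_eq_const_of_bounded one_pos (by norm_num) hbd
  -- the decay along the ray `r • e₁` (`e₁ = EuclideanSpace.single 0 1`) kills the constant
  have hc0 : c = 0 := by
    by_contra hne
    have hcpos : 0 < ‖c‖ := norm_pos_iff.2 hne
    set r : ℝ := |K| / ‖c‖ with hr_def
    have hr : 0 ≤ r := by positivity
    have hy : ‖(r • EuclideanSpace.single 0 1 : E3)‖ = r := by
      rw [norm_smul, PiLp.norm_single, norm_one, mul_one, Real.norm_of_nonneg hr]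
    have h1 := hK' (r • EuclideanSpace.single 0 1)
    rw [hc, hy, le_div_iff₀ (by positivity)] at h1
    have h2 : r * ‖c‖ = |K| := by rw [hr_def, div_mul_cancel₀ _ hcpos.ne']
    nlinarith
  funext y
  rw [hc y, hc0, Pi.zero_apply]

end Summit.NavierStokesRegularity.NavierStokesRegularity.Theorems.SpiralScalingLiouville.Birth

end
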